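import Mathlib
import Summits.Ventures.HodgeRepro2.A2TripleSumWitness
import Summits.Ventures.HodgeRepro2.A2PontryaginModel

/-!
# A2 annex — the triple-sum class is an iterated Pontryagin product: `m₃_*(z₁ ⊗ z₂ ⊗ v) = (z₁ ⋆ z₂) ⋆ v`

Corollary A8.2 (route/T4-A2-p6.md v6 ll. 115–118) writes its class as `y' := m₃_*(f_*c₁ ⊗ f_*c₂ ⊗ θ⁴)`
with `m₃ = m ∘ (m × id_B)` the triple sum; by (A4.3.3) and the functoriality of Gysin maps this is the
iterated Pontryagin product `(f_*c₁ ⋆ f_*c₂) ⋆ θ⁴`.  In the model this file proves the identity on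
the nose, for `z₂` and `v` of even degree (no Koszul signs — the printed «all degrees even»):

* `inr_mul_tmul_of_even`: for `z ∈ ⋀^{2k}`, `(1 ⊗ z) · (x ⊗ y) = x ⊗ (z ∧ y)` in `AA ι` (the sign
  `(−1)^{2k · deg x}` is `1` on every homogeneous component of `x`);
* **`pairTwo_integral_eq_II`**: for even `z₂`, `A2TripleSumPairing.pairTwo (∫ z₁ ∧ ·) (∫ z₂ ∧ ·)` IS
  p5's `II (inl z₁ * inr z₂ * ·)` — the Künneth-expanded pairing of `A2TripleSumPairing` equals the
  genuine `∫_{B×B} (z₁ ⊗ z₂) ∪ (·)` of the model;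
* `theta_pow_mem_grading`: `θ^r ∈ ⋀^{2r}`;
* **`gysinTriple_eq_pontryagin_pontryagin`**: for even `z₂`, `v`,
  `gysinTriple (∫ z₁ ∧ ·) (∫ z₂ ∧ ·) (∫ v ∧ ·) = pontryagin (pontryagin z₁ z₂) v`, and
  **`gysinTriple_theta_eq`** for `v = θ^r`: the class `y'` of Corollary A8.2 is `(z₁ ⋆ z₂) ⋆ θ^r`.

Seat p6 (A2 owner), gen 16.  §8 (d): uses an L-value-free non-vanishing device: NO.
-/

namespace Summit.Ventures.HodgeRepro2.A2TripleSumAssoc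

open WeilPlanes WeilIntegral WeilDetect WeilCoproduct WeilPairing A2TripleSumPairing
  A2TripleSumPairingDegree A2ModelDuality A2TripleSumGysin A2TripleSumWitness A2PontryaginModel
open scoped TensorProduct

variable {ι : Type*} [DecidableEq ι]

/-- `(−1 : ℤˣ)^{2k · i} = 1` (`uzpow`). -/
theorem neg_one_uzpow_two_mul (k i : ℕ) : ((-1 : ℤˣ) ^ (2 * k * i) : ℤˣ) = 1 := by
  rw [uzpow_mul, uzpow_mul, neg_one_uzpow_two, one_uzpow, one_uzpow]

/-- `0 ᵍ⊗ y = 0` in `AA ι`. -/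
theorem zero_gtmul (y : A ι) : ((0 : A ι) ᵍ⊗ₜ[ℂ] y : AA ι) = 0 := by
  simp [GradedTensorProduct.tmul]

/-- `(x + x') ᵍ⊗ y = x ᵍ⊗ y + x' ᵍ⊗ y` in `AA ι`. -/
theorem add_gtmul (x x' y : A ι) :
    ((x + x') ᵍ⊗ₜ[ℂ] y : AA ι) = x ᵍ⊗ₜ[ℂ] y + x' ᵍ⊗ₜ[ℂ] y := by
  simp [GradedTensorProduct.tmul, TensorProduct.add_tmul]

/-- For `z` of even degree, `(1 ⊗ z) · (x ⊗ y) = x ⊗ (z ∧ y)`: no Koszul sign. -/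
theorem inr_mul_tmul_of_even {k : ℕ} {z : A ι} (hz : z ∈ grading ι (2 * k)) (x y : A ι) :
    inr z * (x ᵍ⊗ₜ[ℂ] y) = x ᵍ⊗ₜ[ℂ] (z * y) := by
  rw [show inr z = (1 : A ι) ᵍ⊗ₜ[ℂ] z from GradedTensorProduct.includeRight_apply _ _ _]
  induction x using DirectSum.Decomposition.inductionOn (ℳ := grading ι) with
  | zero => rw [zero_gtmul, zero_gtmul, mul_zero]
  | homogeneous x =>
    have h := GradedTensorProduct.tmul_coe_mul_coe_tmul (grading ι) (grading ι) (1 : A ι)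
      (⟨z, hz⟩ : grading ι (2 * k)) x y
    simp only [one_mul] at h
    rw [h, neg_one_uzpow_two_mul, one_smul]
  | add x x' hx hx' =>
    rw [add_gtmul, mul_add, hx, hx', add_gtmul]

/-- For `z₂` of even degree, the Künneth-expanded pairing `pairTwo (∫ z₁ ∧ ·) (∫ z₂ ∧ ·)` is p5's
`∫_{B×B} (z₁ ⊗ z₂) ∪ (·) = II (inl z₁ * inr z₂ * ·)`. -/
theorem pairTwo_integral_eq_II [Fintype ι] (z₁ : A ι) {k : ℕ} {z₂ : A ι}
    (hz₂ : z₂ ∈ grading ι (2 * k)) (Z : AA ι) :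
    pairTwo (integral ∘ₗ LinearMap.mulLeft ℂ z₁) (integral ∘ₗ LinearMap.mulLeft ℂ z₂) Z =
      II (inl z₁ * inr z₂ * Z) := by
  induction Z using AA_induction with
  | zero => simp
  | tmul x y =>
    rw [pairTwo_tmul, mul_assoc, inr_mul_tmul_of_even hz₂, inl_mul_tmul, II_tmul]
    rfl
  | add Z Z' hZ hZ' => rw [map_add, mul_add, map_add, hZ, hZ']

/-- `θ^r` has degree `2r`. -/
theorem theta_pow_mem_grading [Fintype ι] (c : ι → ℂ) (r : ℕ) :
    theta c ^ r ∈ grading ι (2 * r) := by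
  rw [theta_pow]
  refine Submodule.smul_mem _ _ (Submodule.sum_mem _ fun T hT => Submodule.smul_mem _ _ ?_)
  have := ET_mem_grading T
  rwa [(Finset.mem_powersetCard.mp hT).2] at this

/-- **The triple-sum class is an iterated Pontryagin product.**  For `z₂`, `v` of even degree,
`m₃_*(z₁ ⊗ z₂ ⊗ v) = (z₁ ⋆ z₂) ⋆ v` in the model (`m₃ = m ∘ (m × id)`; Lemma A4.1.1 (ii) twice). -/
theorem gysinTriple_eq_pontryagin_pontryagin [Fintype ι] (z₁ : A ι) {k l : ℕ} {z₂ v : A ι}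
    (hz₂ : z₂ ∈ grading ι (2 * k)) (hv : v ∈ grading ι (2 * l)) :
    gysinTriple (integral ∘ₗ LinearMap.mulLeft ℂ z₁) (integral ∘ₗ LinearMap.mulLeft ℂ z₂)
        (integral ∘ₗ LinearMap.mulLeft ℂ v) =
      pontryagin (pontryagin z₁ z₂) v := by
  symm
  apply dualOf_unique
  intro u
  rw [integral_pontryagin_mul, pairThree_apply]
  have key : ∀ Z : AA ι, II (inl (pontryagin z₁ z₂) * inr v * Z) =
      pairThreeAux (integral ∘ₗ LinearMap.mulLeft ℂ z₁) (integral ∘ₗ LinearMap.mulLeft ℂ z₂)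
        (integral ∘ₗ LinearMap.mulLeft ℂ v) Z := by
    intro Z
    induction Z using AA_induction with
    | zero => simp
    | tmul x y =>
      rw [pairThreeAux_tmul, mul_assoc, inr_mul_tmul_of_even hv, inl_mul_tmul, II_tmul,
        integral_pontryagin_mul, pairTwo_integral_eq_II z₁ hz₂]
      rfl
    | add Z Z' hZ hZ' => rw [mul_add, map_add, map_add, hZ, hZ']
  exact key (cop u)

/-- The class `y'` of Corollary A8.2 with `v = θ^r`: `m₃_*(z₁ ⊗ z₂ ⊗ θ^r) = (z₁ ⋆ z₂) ⋆ θ^r` for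
`z₂` of even degree. -/
theorem gysinTriple_theta_eq [Fintype ι] (z₁ : A ι) {k : ℕ} {z₂ : A ι}
    (hz₂ : z₂ ∈ grading ι (2 * k)) (c : ι → ℂ) (r : ℕ) :
    gysinTriple (integral ∘ₗ LinearMap.mulLeft ℂ z₁) (integral ∘ₗ LinearMap.mulLeft ℂ z₂)
        (psi c r) =
      pontryagin (pontryagin z₁ z₂) (theta c ^ r) :=
  gysinTriple_eq_pontryagin_pontryagin z₁ hz₂ (theta_pow_mem_grading c r)

end Summit.Ventures.HodgeRepro2.A2TripleSumAssoc
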